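import Summits.CriticalPhenomena.SAWScalingLimit.Theorems.SAWLeftRightFKGFKGToTraversalBoundSplitWild
import Summits.CriticalPhenomena.SAWScalingLimit.Theorems.SAWLeftRightFKGFKGToTraversalBoundSplit
import HarnessLib

/-! Scratch (cstrat s2): the landed glue `Split.FKGToTraversalBound_of_subsWild` (p162103) has EXACTLY the type
`CriticalBubbleBound → BubbleFKGEngine → GermTightness → WildNecklaceResidue → FKGToTraversalBound` for the
def-free children of `children.json` (definitional unfolding only: `exact`), and each child is the named currency. -/

namespace Summit.CriticalPhenomena.SAWScalingLimit.Theses.SAWLeftRightFKG.SplitScratch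

open Summit.CriticalPhenomena.SAWScalingLimit.Theses.SAWLeftRightFKG
open Summit.CriticalPhenomena.SAWScalingLimit.Theorems.FKGToTraversalBound

def C_CriticalBubbleBound : Prop :=
  ∃ C : ENNReal, C ≠ ⊤ ∧ ∀ (Ω : Set ℂ) (δ : ℝ) (u v : Literature.Probability.LatticeModels.Site 2), Bornology.IsBounded Ω → 0 < δ → (Literature.Probability.LatticeModels.zdGraph 2).Adj u v → Literature.Probability.RandomPlanarGeometry.SAW.weight Ω δ u v Set.univ ≤ C

def C_BubbleFKGEngine : Prop :=
  LeftRightFKG → (∃ C : ENNReal, C ≠ ⊤ ∧ ∀ (Ω : Set ℂ) (δ : ℝ) (u v : Literature.Probability.LatticeModels.Site 2), Bornology.IsBounded Ω → 0 < δ → (Literature.Probability.LatticeModels.zdGraph 2).Adj u v → Literature.Probability.RandomPlanarGeometry.SAW.weight Ω δ u v Set.univ ≤ C) → ∀ ε : ℝ, 0 < ε → ∀ n₀ : ℕ, ∃ n : ℕ, ∀ (δ : ℝ) (c u v u' v' : Literature.Probability.LatticeModels.Site 2) (C : (Literature.Probability.LatticeModels.zdGraph 2).Walk c c), let Ω : Set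 ℂ := {z | Literature.Topology.PlaneTopology.wind (fun t : ℝ => Set.IccExtend zero_le_one (C.toCurve (Literature.Probability.LatticeModels.meshPoint δ)) t - z) ≠ 0}; 0 < δ → u' ∈ C.support → v' ∈ C.support → (Literature.Probability.LatticeModels.zdGraph 2).Adj u u' → (Literature.Probability.LatticeModels.zdGraph 2).Adj v v' → ∀ (x : ℂ) (ρ R : ℝ), δ ≤ ρ → 2 * ρ ≤ R → (∃ γ₀ : Literature.Probability.RandomPlanarGeometry.SAW.DomainSAW Ω δ u v, ¬ (⟨γ₀.walk.toCurve (Literature.Probability.LatticeModels.meshPoint δ)⟩ : Literature.Probability.RandomPlanarGeometry.Curve ℂ).HasTraversals (n₀ + 1) x ((3 * ρ + R) / 4) ((ρ + 3 * R) / 4)) → Literature.Probability.RandomPlanarGeometry.SAW.law Ω δ u v {γ | (⟨γ.walk.toCurve (Literature.Probability.LatticeModels.meshPoint δ)⟩ : Literature.Probability.RandomPlanarGeometry.Curve ℂ).HasTraversals n x ρ R} ≤ ENNReal.ofReal ε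

def C_GermTightness : Prop :=
  ∀ (D : Literature.Probability.RandomPlanarGeometry.DobrushinDomain) (a b : ℝ → Literature.Probability.LatticeModels.Site 2), Literature.Probability.RandomPlanarGeometry.SAW.IsEndpointApprox D a b → (∀ r : ℝ, 0 < r → ∀ ε : ℝ, 0 < ε → ∃ n : ℕ, ∀ᶠ δ in nhdsWithin (0 : ℝ) (Set.Ioi 0), Literature.Probability.RandomPlanarGeometry.SAW.law D.carrier δ (a δ) (b δ) {γ | (⟨γ.walk.toCurve (Literature.Probability.LatticeModels.meshPoint δ)⟩ : Literature.Probability.RandomPlanarGeometry.Curve ℂ).HasTraversals n (Literature.Probability.LatticeModels.meshPoint δ (a δ)) (2 * Metric.infDist (Literature.Probability.LatticeModels.meshPoint δ (a δ)) D.carrierᶜ + 4 * δ) r} ≤ ENNReal.ofReal ε) ∧ (∀ r : ℝ, 0 < r → ∀ ε : ℝ, 0 < ε → ∃ n : ℕ, ∀ᶠ δ in nhdsWithin (0 : ℝ) (Set.Ioi 0), Literature.Probability.RandomPlanarGeometry.SAW.law D.carrier δ (a δ) (b δ) {γ | (⟨γ.walk.toCurve (Literature.Probability.LatticeModels.meshPoint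 δ)⟩ : Literature.Probability.RandomPlanarGeometry.Curve ℂ).HasTraversals n (Literature.Probability.LatticeModels.meshPoint δ (b δ)) (2 * Metric.infDist (Literature.Probability.LatticeModels.meshPoint δ (b δ)) D.carrierᶜ + 4 * δ) r} ≤ ENNReal.ofReal ε)

def C_WildNecklaceResidue : Prop :=
  (∀ ε : ℝ, 0 < ε → ∀ n₀ : ℕ, ∃ n : ℕ, ∀ (δ : ℝ) (c u v u' v' : Literature.Probability.LatticeModels.Site 2) (C : (Literature.Probability.LatticeModels.zdGraph 2).Walk c c), let Ω : Set ℂ := {z | Literature.Topology.PlaneTopology.wind (fun t : ℝ => Set.IccExtend zero_le_one (C.toCurve (Literature.Probability.LatticeModels.meshPoint δ)) t - z) ≠ 0}; 0 < δ → u' ∈ C.support → v' ∈ C.support → (Literature.Probability.LatticeModels.zdGraph 2).Adj u u' → (Literature.Probability.LatticeModels.zdGraph 2).Adj v v' → ∀ (x : ℂ) (ρ R : ℝ), δ ≤ ρ → 2 * ρ ≤ R → (∃ γ₀ : Literature.Probability.RandomPlanarGeometry.SAW.DomainSAW Ω δ u v, ¬ (⟨γ₀.walk.toCurve (Literature.Probability.LatticeModels.meshPoint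 δ)⟩ : Literature.Probability.RandomPlanarGeometry.Curve ℂ).HasTraversals (n₀ + 1) x ((3 * ρ + R) / 4) ((ρ + 3 * R) / 4)) → Literature.Probability.RandomPlanarGeometry.SAW.law Ω δ u v {γ | (⟨γ.walk.toCurve (Literature.Probability.LatticeModels.meshPoint δ)⟩ : Literature.Probability.RandomPlanarGeometry.Curve ℂ).HasTraversals n x ρ R} ≤ ENNReal.ofReal ε) → ∀ (D : Literature.Probability.RandomPlanarGeometry.DobrushinDomain) (a b : ℝ → Literature.Probability.LatticeModels.Site 2), Literature.Probability.RandomPlanarGeometry.SAW.IsEndpointApprox D a b → ¬ (∃ N₀ : ℕ, ∀ᶠ δ in nhdsWithin (0 : ℝ) (Set.Ioi 0), ∃ (c : Literature.Probability.LatticeModels.Site 2) (C : (Literature.Probability.LatticeModels.zdGraph 2).Walk c c) (S : Finset (Literature.Probability.LatticeModels.Site 2)), S.card ≤ N₀ ∧ ∀ x y : Literature.Probability.LatticeModels.Site 2, (Literature.Probability.LatticeModels.discreteDomainGraph {z | Literature.Topology.PlaneTopology.wind (fun t : ℝ => Set.IccExtend zero_le_one (C.toCurve (Literature.Probability.LatticeModels.meshPoint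 δ)) t - z) ≠ 0} δ).Adj x y ↔ ((Literature.Probability.LatticeModels.discreteDomainGraph D.carrier δ).Adj x y ∧ x ∉ S ∧ y ∉ S)) → (∀ r : ℝ, 0 < r → ∀ ε : ℝ, 0 < ε → ∃ n : ℕ, ∀ᶠ δ in nhdsWithin (0 : ℝ) (Set.Ioi 0), Literature.Probability.RandomPlanarGeometry.SAW.law D.carrier δ (a δ) (b δ) {γ | (⟨γ.walk.toCurve (Literature.Probability.LatticeModels.meshPoint δ)⟩ : Literature.Probability.RandomPlanarGeometry.Curve ℂ).HasTraversals n (Literature.Probability.LatticeModels.meshPoint δ (a δ)) (2 * Metric.infDist (Literature.Probability.LatticeModels.meshPoint δ (a δ)) D.carrierᶜ + 4 * δ) r} ≤ ENNReal.ofReal ε) → (∀ r : ℝ, 0 < r → ∀ ε : ℝ, 0 < ε → ∃ n : ℕ, ∀ᶠ δ in nhdsWithin (0 : ℝ) (Set.Ioi 0), Literature.Probability.RandomPlanarGeometry.SAW.law D.carrier δ (a δ) (b δ) {γ | (⟨γ.walk.toCurve (Literature.Probability.LatticeModels.meshPoint δ)⟩ : Literature.Probability.RandomPlanarGeometry.Curve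 ℂ).HasTraversals n (Literature.Probability.LatticeModels.meshPoint δ (b δ)) (2 * Metric.infDist (Literature.Probability.LatticeModels.meshPoint δ (b δ)) D.carrierᶜ + 4 * δ) r} ≤ ENNReal.ofReal ε) → ∀ (x : ℂ) (ρ R : ℝ), 0 < ρ → 2 * ρ ≤ R → R ≤ 1 → ∀ ε : ℝ, 0 < ε → ∃ n : ℕ, ∀ᶠ δ in nhdsWithin (0 : ℝ) (Set.Ioi 0), Literature.Probability.RandomPlanarGeometry.SAW.law D.carrier δ (a δ) (b δ) {γ | (⟨γ.walk.toCurve (Literature.Probability.LatticeModels.meshPoint δ)⟩ : Literature.Probability.RandomPlanarGeometry.Curve ℂ).HasTraversals n x ρ R} ≤ ENNReal.ofReal ε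

/-- The `--glue-by` target has the children's type (term-mode `exact`, no rewriting). -/
theorem glue_matches : C_CriticalBubbleBound → C_BubbleFKGEngine → C_GermTightness → C_WildNecklaceResidue →
    FKGToTraversalBound :=
  Split.FKGToTraversalBound_of_subsWild

/-- Same, with the children unfolded by `fun`-application (the gate may state the check either way). -/
example (h₁ : C_CriticalBubbleBound) (h₂ : C_BubbleFKGEngine) (h₃ : C_GermTightness) (h₄ : C_WildNecklaceResidue) :
    FKGToTraversalBound :=
  Split.FKGToTraversalBound_of_subsWild h₁ h₂ h₃ h₄

/-- Child 1 IS stmt-CriticalPhenomena-7117 (`SAWTotalPositivity.CriticalBubbleBound`). -/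
example : C_CriticalBubbleBound ↔ Summit.CriticalPhenomena.SAWScalingLimit.Theses.SAWTotalPositivity.CriticalBubbleBound := Iff.rfl
/-- Child 2 IS the registered `stub_engine` statement. -/
example : C_BubbleFKGEngine ↔ (LeftRightFKG → Summit.CriticalPhenomena.SAWScalingLimit.Theses.SAWTotalPositivity.CriticalBubbleBound → SlitNecklace.UniformSubshellTight) := Iff.rfl
/-- Child 3 IS the registered `stub_germTight` statement. -/
example : C_GermTightness ↔ (∀ (D : Literature.Probability.RandomPlanarGeometry.DobrushinDomain) (a b : ℝ → Literature.Probability.LatticeModels.Site 2), Literature.Probability.RandomPlanarGeometry.SAW.IsEndpointApprox D a b → SlitNecklace.GermTight D a b a ∧ SlitNecklace.GermTight D a b b) := Iff.rfl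
/-- Child 4 IS the registered `stub_wildDomains` statement. -/
example : C_WildNecklaceResidue ↔ (SlitNecklace.UniformSubshellTight → ∀ (D : Literature.Probability.RandomPlanarGeometry.DobrushinDomain) (a b : ℝ → Literature.Probability.LatticeModels.Site 2), Literature.Probability.RandomPlanarGeometry.SAW.IsEndpointApprox D a b → ¬ SlitNecklace.EventuallyTame D → SlitNecklace.GermTight D a b a → SlitNecklace.GermTight D a b b → SlitNecklace.EventualShellTight D a b) := Iff.rfl

/-- The s1 glue (`Split.FKGToTraversalBound_of_subs`, child 4 = the full necklace reduction) is recovered from the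
sharper one through the landed `necklaceReduction_of_wildResidue` direction… (converse bookkeeping: full ⇒ wild). -/
example (h₁ : C_CriticalBubbleBound) (h₂ : C_BubbleFKGEngine) (h₃ : C_GermTightness)
    (hN : SlitNecklace.UniformSubshellTight → ∀ (D : Literature.Probability.RandomPlanarGeometry.DobrushinDomain) (a b : ℝ → Literature.Probability.LatticeModels.Site 2), Literature.Probability.RandomPlanarGeometry.SAW.IsEndpointApprox D a b → SlitNecklace.GermTight D a b a → SlitNecklace.GermTight D a b b → SlitNecklace.EventualShellTight D a b) :
    FKGToTraversalBound :=
  Split.FKGToTraversalBound_of_subsWild h₁ h₂ h₃ (fun hE D a b hab _ => hN hE D a b hab)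

end Summit.CriticalPhenomena.SAWScalingLimit.Theses.SAWLeftRightFKG.SplitScratch
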